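import Literature.MathematicalPhysics.QuantumFieldTheory.Balaban1983to89.B11Eq80CurrentZpow
import Literature.MathematicalPhysics.QuantumFieldTheory.Balaban1983to89.B11Eq98CurrentSlot

/-!
# `Balaban1983to89.B11Eq81ExpansionZpow` — T. Bałaban, *The variational problem and background fields in renormalization group method for lattice gauge theories*, Commun. Math. Phys. **102** (1985) 277–309 [Balaban1985Variational]: (74) p. 289, (78)–(81) p. 290, (84) p. 290 — THE EXPANSION `𝔉(A′) = A(U₀) + ⟨A′, J⟩ + ½⟨A′, Δ₁A′⟩ + V(A′)` OF THE WILSON ACTION IN THE CHART (47), ON THE LATTICE, EVERY `d`, and its ray derivative (84) `(d/dt)𝔉(A′ + tδ)|₀ = ⟨δ, J⟩ + ⟨δ, Δ₁A′⟩ + ⟨W(A′), δ⟩`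

statement-level skeleton of published theorems with citation tags; proofs where landed; nothing here is a claim about the Yang–Mills mass gap

PDF held: `paper:balaban1985-cmp102-variational-background` (journal page = PDF page + 276); pp. 289–290 as transcribed verbatim in
`B11Eq81Expansion` (the (74)/(78)–(84) quotation there is not repeated).

CITATION HEADER (lean-in-tree rule 2026-08-18).  WHAT IS REPRODUCED: rows `B11.Eq74`/`B11.Eq78`/`B11.Eq82` of r08's `ROWS-B11.md` — the
expansion (74) → (81) and the derivative (84) — ON THE LATTICE CARRIER of the (26)/(63)/(80) lineage: the integer-power Wilson action
`B9Eq31ActionZpow.actionZ` of (5), the chart (47) `B11Eq90V0GroupComposed.T47`, the current `J := B11Eq98CurrentSlot.Jcur U₀` of (27)/(28)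
in the `|·|₍₋₃₎`-carrier, the functional `V` of (80) with the integer-power `V₀` (`B11Eq80CurrentZpow.V80Z`) and its derivative
`W = (δ/δA′)V` (`B11Eq80Current.W80`, (63)-certified in every `d` by `B11Eq80CurrentZpow.pair27_W80_zpow`).  The tree's `B11Eq81Expansion.eq81`
is the SAME algebra over an abstract real inner-product space with `V₀` a letter; this file is its lattice reading, for every dimension `d`
(in particular `d = 3`, rung R3 of cell `ym3-torus`), with the two analytic inputs of pp. 289–290 DISPLAYED as rows:
* (r74) **`h74`** — [Balaban1985BackgroundPropagators] (3.119) / (87): «⟨Y, Δ_π Y⟩ = ⟨Y, ΔY⟩» for `Y` in the Landau-type gauge subspace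
  (`pair27 τ (Δπ Y) (flat115 Y) = hessPair … (curL (flat115 Y))`, `P Y`), with `P` an ABSTRACT predicate (print: (76)–(77)) and the closure
  row **`hPT`** «`P A′ → P (A′ − HD(A′))`» (print: (45) `RD*H = 0`);
* (r79) **`h79`** — (79) read as the DEFINITION of the letter `Δ₁ = Δ_π − Δ_π⁽²⁾` through (78), ON THE SUBSPACE `P` (the member's (79) operator is the
  gauge-invariant extension [5] (3.128), agreeing with `Δ_π − Δ_π⁽²⁾` on Landau `Y`): `P Y → ⟨Δ₁Y, Y⟩ = ⟨Δ_πY, Y⟩ − 2⟨J, HC⁽²⁾(Y)⟩`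
  (`quadPart C` = print's `C⁽²⁾`, `E3 = HD − HC⁽²⁾ = HD₃` of `B11Eq80Current`), and (rΔ₁) **`hΔ₁`** its bilinear symmetry (for (84) only).
WHAT IS PROVED (sorry-free; no definition; `Δ₁`, `Δπ` binders):
* §1 ★★ **`actionZ_chart_eq81`** — (74) = (81) ON THE LATTICE: `A(U₁(A′ − HD(A′))·U₀) = A(U₀) + ⟨A′, J⟩ + ½⟨A′, Δ₁A′⟩ + V(A′)` for `A′` with
  `P (T47 A′)`, from (26) in every `d` (`B11Eq26ExpansionZpow.eq26_zpow`) + (27) (`pair27_Jcur`) + (r74) + (78) + (r79) + the bilinear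
  symmetry of `Δ_π` — print's p. 289–290 text, step by step; `actionZ_chart_eq81_of_mem` (the `P`-closure form).
* §2 ★★★ **`hasDerivAt_actionZ_chartRay`** (complex ray) / **`hasDerivAt_actionZ_chartRay_real`** (real ray) — (84) ON THE LATTICE, EVERY `d`:
  `(d/dt) A(chart(A′ + tδ))|_{t=0} = ⟨J, δ⟩ + ⟨Δ₁A′, δ⟩ + ⟨W(A′), δ⟩` (sum of three, this order) for `A′`, `δ` in the subspace `P` (closure
  rows displayed), on `‖A′‖ < a_C`; the `V`-third is `B11Eq80CurrentZpow.hasDerivAt_V80Z_line`; `hasDerivAt_rhs81_line` is the pure-calculus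
  derivative of (81)'s right side (no gauge condition).
DICTIONARY.  As `B11Eq80CurrentZpow` (nothing re-declared); `A(·) ↦ actionZ Tsh η d τ`, `U₁U₀ ↦ prodCfg (Ucur U₀) η (curL (flat115 ·))`,
`⟨K, Y⟩ ↦ pair27 τ K (flat115 Y)`, `⟨Y, ΔY⟩ ↦ hessPair Tsh (Ucur U₀) η d τ (curL (flat115 Y))`, `J ↦ Jcur U₀`, `HD ↦ Emap`, `HD₃ ↦ E3`,
`C⁽²⁾ ↦ quadPart C`, `A′ − HD(A′) ↦ T47 H C εC A′`.
HONEST SCOPE — what is NOT claimed.  (i) (3.119)/(87) and the representation (79) of `Δ_π⁽²⁾` are DISPLAYED (rows `h74`, `hPT`, `h79`, `hΔ₁`),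
not proved; the cell's member instantiation (letters (W-X′) of `ym3-torus`'s EX namer, `Δ₁ :=` the (79) operator at the member) discharges them.
(ii) The (63) hypotheses (`hρ`, `hτ`, Sect. C regime `RC`, `hC`, `hΔ`, `‖A′‖ < a_C`) are those of `pair27_W80_zpow`.  (iii) Nothing of Prop. 4's
estimate (98), of (82)–(83)'s tangent-space description beyond the abstract `P`, or of Sect. C (99)–(111) is here.  (iv) Not summit progress:
YM₃ on T³ is a ladder rung (R3), not d = 4, not Clay; no stub, crux or mass-gap claim.  Cell `ym3-torus`, width seat `ym3-torus-px19` (gen 2),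
`--supports stmt-QuantumFields-19200`; count-neutral.
Depends on (BY NAME): `B11Eq80CurrentZpow` (`V80Z`, `hasDerivAt_V80Z_line`), `B11Eq80Current` (`W80`, `Emap`, `E3`, `quadPart`, `pairL`,
`pairL_apply`, `Emap_eq_sub`, `hasDerivAt_line`), `B11Eq98CurrentSlot` (`Jcur`, `pair27_Jcur`), `B11Eq90V0GroupComposed` (`T47`),
`B11Eq90Transpose` (`pair27`, `pair27_sub_left`), `B11Eq26ExpansionZpow` (`eq26_zpow`, `V0Z`), `B9Eq31ActionZpow` (`actionZ`), `B9Eq39Adjoint`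
(`prodCfg`, `hessPair`, `bondPair`, `J`).
-/

noncomputable section

open NormedSpace Complex Metric Set Finset Filter Topology

namespace Literature.MathematicalPhysics.QuantumFieldTheory.Balaban1983to89.B11Eq81ExpansionZpow

open Literature.MathematicalPhysics.QuantumFieldTheory.Balaban1983to89.B9Eq39Adjoint (bondPair posPlaq hessPair prodCfg)
open Literature.MathematicalPhysics.QuantumFieldTheory.Balaban1983to89.B9Eq31ActionZpow (actionZ)
open Literature.MathematicalPhysics.QuantumFieldTheory.Balaban1983to89.B11Prop6Scheme (Prop4Hyp)
open Literature.MathematicalPhysics.QuantumFieldTheory.Balaban1983to89.B11Eq174Chart (solA Regime)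
open Literature.MathematicalPhysics.QuantumFieldTheory.Balaban1983to89.B11Eq26ExpansionZpow (V0Z eq26_zpow)
open Literature.MathematicalPhysics.QuantumFieldTheory.Balaban1983to89.B11Eq90V0primeCurrent (Tsh Ucur curL curL_apply flat115
  flat115_apply)
open Literature.MathematicalPhysics.QuantumFieldTheory.Balaban1983to89.B11Eq98CurrentSlot (Jcur pair27_Jcur)
open Literature.MathematicalPhysics.QuantumFieldTheory.Balaban1983to89.B11Eq90Transpose
open Literature.MathematicalPhysics.QuantumFieldTheory.Balaban1983to89.B11Eq90V0GroupComposed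
open Literature.MathematicalPhysics.QuantumFieldTheory.Balaban1983to89.B11Eq80Current
open Literature.MathematicalPhysics.QuantumFieldTheory.Balaban1983to89.B11Eq80CurrentZpow
open B9SectCLatticeCarrier (Bond)
open B4Sect5Torus (TSite)
open B11Eq115Space

variable {𝔸 : Type*} [NormedRing 𝔸] [NormedAlgebra ℂ 𝔸]
variable {d : ℕ} {Pd : Fin d → ℕ} {L η : ℝ} [Fact (0 < L)] [Fact (0 < η)] {lev₀ : Bond d Pd → ℕ} {κ' : Type*} [Fintype κ']
  {lev₁ : κ' → ℕ} {Dc : (Bond d Pd → 𝔸) →ₗ[ℂ] (κ' → 𝔸)}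
variable {𝒳 : Type*} [NormedAddCommGroup 𝒳] [NormedSpace ℂ 𝒳]
variable [FiniteDimensional ℂ 𝔸] [CompleteSpace 𝔸] {H : 𝒳 →L[ℂ] Space115 L η lev₀ lev₁ Dc} {C : Space115 L η lev₀ lev₁ Dc → 𝒳}
  {b C₂ c₄ aC εC : ℝ}
variable {ρ : (𝔸 →L[ℂ] ℂ) →L[ℂ] 𝔸} {τ : 𝔸 →L[ℂ] ℂ}

/-! ## §0 Bookkeeping: the pairing (27) is bilinear in the configuration slot -/

omit [CompleteSpace 𝔸] in
/-- `⟨K, Y − Z⟩ = ⟨K, Y⟩ − ⟨K, Z⟩` (the pairing (27) through `B11Eq80Current.pairL`). [cite: Balaban1985Variational, (27) p.282] -/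
theorem pair27_flat115_sub (K : NegSize L η lev₀ 3 𝔸) (Y Z : Space115 L η lev₀ lev₁ Dc) :
    pair27 τ K (flat115 (Y - Z)) = pair27 τ K (flat115 Y) - pair27 τ K (flat115 Z) := by
  rw [← pairL_apply, ← pairL_apply, ← pairL_apply, map_sub]

omit [CompleteSpace 𝔸] in
/-- `⟨K, Y + Z⟩ = ⟨K, Y⟩ + ⟨K, Z⟩`. [cite: Balaban1985Variational, (27) p.282] -/
theorem pair27_flat115_add (K : NegSize L η lev₀ 3 𝔸) (Y Z : Space115 L η lev₀ lev₁ Dc) :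
    pair27 τ K (flat115 (Y + Z)) = pair27 τ K (flat115 Y) + pair27 τ K (flat115 Z) := by
  rw [← pairL_apply, ← pairL_apply, ← pairL_apply, map_add]

/-! ## §1 (74) → (81): the expansion of the action in the chart (47), on the lattice, every `d` -/

/-- ★★ **(74) = (81) ON THE LATTICE, EVERY `d`.**  For a configuration `A′` of the space (115) whose chart value `A′ − HD(A′) = T47 A′` lies
in the gauge subspace `P` (print: the Landau conditions (76)–(77) together with (45) `RD*H = 0`):
`A(U₁(A′ − HD(A′))·U₀) = A(U₀) + ⟨A′, J⟩ + ½⟨A′, Δ₁A′⟩ + V(A′)`, with `A` the integer-power Wilson action (5), `J = Jcur U₀` the current (27)/(28),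
`V = V80Z` of (80) and `Δ₁` the letter of (79).  PROOF = print's text: (26) for `A := A′ − HD(A′)` (`eq26_zpow`); `⟨A, J⟩ = ⟨A′, J⟩ −
⟨HD(A′), J⟩` with (78) `⟨HD(A′), J⟩ = ⟨HC⁽²⁾(A′), J⟩ + ⟨HD₃(A′), J⟩` (definitional: `E3 = Emap − H ∘ quadPart C`); `½⟨A, ΔA⟩ = ½⟨A, Δ_πA⟩`
(row `h74` at `A`); expand by bilinearity and the symmetry `hΔ` of `Δ_π`; (79) (row `h79`) names `½⟨A′, Δ_πA′⟩ − ⟨HC⁽²⁾(A′), J⟩ =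
½⟨A′, Δ₁A′⟩`; the rest is `V(A′)` by (80).  DISPLAYED: `h74` (at the one value `T47 A′`), `h79` (at the one value `A′`), `hΔ`.
[cite: Balaban1985Variational, (74) p.289, (78)–(81) p.290, (26) p.282] -/
theorem actionZ_chart_eq81 (hτ : ∀ a b : 𝔸, τ (a * b) = τ (b * a)) (U₀ : Bond d Pd → 𝔸ˣ) (εC : ℝ)
    {Δπ Δ₁ : Space115 L η lev₀ lev₁ Dc →L[ℂ] NegSize L η lev₀ 3 𝔸}
    (hΔ : ∀ Y Z : Space115 L η lev₀ lev₁ Dc, pair27 τ (Δπ Y) (flat115 Z) = pair27 τ (Δπ Z) (flat115 Y))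
    (A' : Space115 L η lev₀ lev₁ Dc)
    (h74 : pair27 τ (Δπ (T47 H C εC A')) (flat115 (T47 H C εC A'))
      = hessPair Tsh (Ucur U₀) η d (τ : 𝔸 →ₗ[ℂ] ℂ) (curL (flat115 (T47 H C εC A'))))
    (h79 : pair27 τ (Δ₁ A') (flat115 A')
      = pair27 τ (Δπ A') (flat115 A') - 2 * pair27 τ (Jcur (L := L) (η := η) (lev₀ := lev₀) U₀) (flat115 (H (quadPart C A')))) :
    actionZ Tsh η d (τ : 𝔸 →ₗ[ℂ] ℂ) (prodCfg (Ucur U₀) η (curL (flat115 (T47 H C εC A'))))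
      = actionZ Tsh η d (τ : 𝔸 →ₗ[ℂ] ℂ) (Ucur U₀) + pair27 τ (Jcur (L := L) (η := η) (lev₀ := lev₀) U₀) (flat115 A')
        + 2⁻¹ * pair27 τ (Δ₁ A') (flat115 A') + V80Z τ U₀ H C εC (Jcur (L := L) (η := η) (lev₀ := lev₀) U₀) Δπ A' := by
  -- (26) at `A := A′ − HD(A′)`, (27) for the current, (74) for the Hessian term, (79) at `A′`
  rw [eq26_zpow Tsh (Ucur U₀) η d (τ : 𝔸 →ₗ[ℂ] ℂ) (curL (flat115 (T47 H C εC A'))),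
    ← pair27_Jcur (L := L) (lev₀ := lev₀) τ hτ U₀ (flat115 (T47 H C εC A')), ← h74, h79]
  -- `A′ − HD(A′)`, (78) `HD = HC⁽²⁾ + HD₃`, (80)
  have hT : T47 H C εC A' = A' - Emap H C εC A' := by rw [Emap_eq_sub]; abel
  have hX := hΔ A' (Emap H C εC A')
  simp only [V80Z, E3, hT, map_sub Δπ, pair27_flat115_sub, pair27_sub_left]
  rw [hX]
  ring

/-- **(74) = (81), `P`-FORM**: the same with (3.119)/(87) displayed for EVERY `Y` of an abstract gauge subspace `P` (print: (76)–(77)) and the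
closure value `P (T47 A′)` supplied as a hypothesis (print: (45) `RD*H = 0` keeps `A′ − HD(A′)` in the subspace); (79) is displayed ON THE SUBSPACE
(row `h79 : ∀ Y, P Y → …` — at the member the (79) operator is the gauge-invariant extension [5] (3.128), which agrees with
`Δ_π − Δ_π⁽²⁾` exactly on Landau `Y`; the located inhabitability condition of cell `ym3-torus`'s Sect. C seat).
[cite: Balaban1985Variational, (74) p.289, (81) p.290, (45) p.285, (76)–(77) p.289] -/
theorem actionZ_chart_eq81_of_mem (hτ : ∀ a b : 𝔸, τ (a * b) = τ (b * a)) (U₀ : Bond d Pd → 𝔸ˣ) (εC : ℝ)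
    {Δπ Δ₁ : Space115 L η lev₀ lev₁ Dc →L[ℂ] NegSize L η lev₀ 3 𝔸}
    (hΔ : ∀ Y Z : Space115 L η lev₀ lev₁ Dc, pair27 τ (Δπ Y) (flat115 Z) = pair27 τ (Δπ Z) (flat115 Y))
    (P : Space115 L η lev₀ lev₁ Dc → Prop)
    (h74 : ∀ Y : Space115 L η lev₀ lev₁ Dc, P Y →
      pair27 τ (Δπ Y) (flat115 Y) = hessPair Tsh (Ucur U₀) η d (τ : 𝔸 →ₗ[ℂ] ℂ) (curL (flat115 Y)))
    (h79 : ∀ Y : Space115 L η lev₀ lev₁ Dc, P Y → pair27 τ (Δ₁ Y) (flat115 Y)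
      = pair27 τ (Δπ Y) (flat115 Y) - 2 * pair27 τ (Jcur (L := L) (η := η) (lev₀ := lev₀) U₀) (flat115 (H (quadPart C Y))))
    {A' : Space115 L η lev₀ lev₁ Dc} (hPA : P A') (hPT : P (T47 H C εC A')) :
    actionZ Tsh η d (τ : 𝔸 →ₗ[ℂ] ℂ) (prodCfg (Ucur U₀) η (curL (flat115 (T47 H C εC A'))))
      = actionZ Tsh η d (τ : 𝔸 →ₗ[ℂ] ℂ) (Ucur U₀) + pair27 τ (Jcur (L := L) (η := η) (lev₀ := lev₀) U₀) (flat115 A')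
        + 2⁻¹ * pair27 τ (Δ₁ A') (flat115 A') + V80Z τ U₀ H C εC (Jcur (L := L) (η := η) (lev₀ := lev₀) U₀) Δπ A' :=
  actionZ_chart_eq81 hτ U₀ εC hΔ A' (h74 _ hPT) (h79 _ hPA)

/-! ## §2 (84): the ray derivative of the action in the chart, on the lattice, every `d` -/

/-- **THE RIGHT SIDE OF (81) ALONG A COMPLEX RAY HAS DERIVATIVE (84) AT `t = 0`** — pure calculus, no gauge condition: `A(U₀)` constant,
`⟨A′ + tδ, J⟩` linear, `½⟨A′ + tδ, Δ₁(A′ + tδ)⟩` by the product rule and the symmetry of `Δ₁` (row `hΔ₁`), `V(A′ + tδ)` by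
`B11Eq80CurrentZpow.hasDerivAt_V80Z_line` ((63), every `d`).  Derivative: `⟨J, δ⟩ + ⟨Δ₁A′, δ⟩ + ⟨W(A′), δ⟩`.
[cite: Balaban1985Variational, (84) p.290, (63) p.287] -/
theorem hasDerivAt_rhs81_line (hρ : ∀ (ℓ : 𝔸 →L[ℂ] ℂ) (X : 𝔸), τ (ρ ℓ * X) = ℓ X) (hτ : ∀ a b : 𝔸, τ (a * b) = τ (b * a))
    (U₀ : Bond d Pd → 𝔸ˣ) (RC : Regime H 0 C b 0 C₂ c₄ 0 aC εC) (hC : Prop4Hyp C C₂ c₄) [CompleteSpace 𝒳]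
    {Δπ Δ₁ : Space115 L η lev₀ lev₁ Dc →L[ℂ] NegSize L η lev₀ 3 𝔸}
    (hΔ : ∀ Y Z : Space115 L η lev₀ lev₁ Dc, pair27 τ (Δπ Y) (flat115 Z) = pair27 τ (Δπ Z) (flat115 Y))
    (hΔ₁ : ∀ Y Z : Space115 L η lev₀ lev₁ Dc, pair27 τ (Δ₁ Y) (flat115 Z) = pair27 τ (Δ₁ Z) (flat115 Y))
    {A' : Space115 L η lev₀ lev₁ Dc} (hA' : ‖A'‖ < aC) (δ' : Space115 L η lev₀ lev₁ Dc) :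
    HasDerivAt (fun t : ℂ => actionZ Tsh η d (τ : 𝔸 →ₗ[ℂ] ℂ) (Ucur U₀)
        + pair27 τ (Jcur (L := L) (η := η) (lev₀ := lev₀) U₀) (flat115 (A' + t • δ'))
        + 2⁻¹ * pair27 τ (Δ₁ (A' + t • δ')) (flat115 (A' + t • δ'))
        + V80Z τ U₀ H C εC (Jcur (L := L) (η := η) (lev₀ := lev₀) U₀) Δπ (A' + t • δ'))
      (pair27 τ (Jcur (L := L) (η := η) (lev₀ := lev₀) U₀) (flat115 δ') + pair27 τ (Δ₁ A') (flat115 δ')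
        + pair27 τ (W80 ρ τ U₀ H C εC (Jcur (L := L) (η := η) (lev₀ := lev₀) U₀) Δπ A') (flat115 δ')) 0 := by
  have h0 : HasDerivAt (fun _ : ℂ => actionZ Tsh η d (τ : 𝔸 →ₗ[ℂ] ℂ) (Ucur U₀)) 0 0 := hasDerivAt_const _ _
  have h1 : HasDerivAt (fun t : ℂ => pair27 τ (Jcur (L := L) (η := η) (lev₀ := lev₀) U₀) (flat115 (A' + t • δ')))
      (pair27 τ (Jcur (L := L) (η := η) (lev₀ := lev₀) U₀) (flat115 δ')) 0 := by
    have h := (pairL (lev₁ := lev₁) (Dc := Dc) τ (Jcur (L := L) (η := η) (lev₀ := lev₀) U₀)).hasFDerivAt.comp_hasDerivAt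
      (0 : ℂ) (hasDerivAt_line A' δ')
    simpa only [Function.comp_def, pairL_apply] using h
  have h2 : HasDerivAt (fun t : ℂ => 2⁻¹ * pair27 τ (Δ₁ (A' + t • δ')) (flat115 (A' + t • δ')))
      (2⁻¹ * (pair27 τ (Δ₁ A') (flat115 δ') + pair27 τ (Δ₁ δ') (flat115 A'))) 0 := by
    have hu : HasDerivAt (fun t : ℂ => Δ₁ (A' + t • δ')) (Δ₁ δ') 0 :=
      Δ₁.hasFDerivAt.comp_hasDerivAt (0 : ℂ) (hasDerivAt_line A' δ')
    have h := (ContinuousLinearMap.hasDerivAt_of_bilinear (B := pairL (lev₁ := lev₁) (Dc := Dc) τ)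
      (fun _ => hu) (fun _ => hasDerivAt_line A' δ')).const_mul (2⁻¹ : ℂ)
    simpa only [pairL_apply, zero_smul, add_zero] using h
  have h3 := hasDerivAt_V80Z_line hρ hτ U₀ RC hC (Jcur (L := L) (η := η) (lev₀ := lev₀) U₀) hΔ hA' δ'
  have hsum := ((h0.fun_add h1).fun_add h2).fun_add h3
  refine hsum.congr_deriv ?_
  rw [hΔ₁ δ' A']
  ring

/-- ★★★ **(84) ON THE LATTICE, COMPLEX RAY, EVERY `d`**: for `A′`, `δ` in the gauge subspace `P` ((76)–(77); `P` closed under `+` and complex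
scalars, and (45): `P Y → P (T47 Y)` on the ball) and `‖A′‖ < a_C`, the chart ray of the Wilson action
`t ↦ A(U₁((A′ + tδ) − HD(A′ + tδ))·U₀)` HAS DERIVATIVE `⟨J, δ⟩ + ⟨Δ₁A′, δ⟩ + ⟨W(A′), δ⟩` at `t = 0` — (81) along the ray (§1, valid near
`t = 0` inside the ball) and `hasDerivAt_rhs81_line`.  With `W = (δ/δA′)V` (63)-certified in every `d` this is print's (84); at `d = 3` it is the
row the Sect. C instantiator of rung R3 consumes. [cite: Balaban1985Variational, (84) p.290, (81) p.290, (82)–(83) p.290] -/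
theorem hasDerivAt_actionZ_chartRay (hρ : ∀ (ℓ : 𝔸 →L[ℂ] ℂ) (X : 𝔸), τ (ρ ℓ * X) = ℓ X) (hτ : ∀ a b : 𝔸, τ (a * b) = τ (b * a))
    (U₀ : Bond d Pd → 𝔸ˣ) (RC : Regime H 0 C b 0 C₂ c₄ 0 aC εC) (hC : Prop4Hyp C C₂ c₄) [CompleteSpace 𝒳]
    {Δπ Δ₁ : Space115 L η lev₀ lev₁ Dc →L[ℂ] NegSize L η lev₀ 3 𝔸}
    (hΔ : ∀ Y Z : Space115 L η lev₀ lev₁ Dc, pair27 τ (Δπ Y) (flat115 Z) = pair27 τ (Δπ Z) (flat115 Y))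
    (hΔ₁ : ∀ Y Z : Space115 L η lev₀ lev₁ Dc, pair27 τ (Δ₁ Y) (flat115 Z) = pair27 τ (Δ₁ Z) (flat115 Y))
    (P : Space115 L η lev₀ lev₁ Dc → Prop)
    (h74 : ∀ Y : Space115 L η lev₀ lev₁ Dc, P Y →
      pair27 τ (Δπ Y) (flat115 Y) = hessPair Tsh (Ucur U₀) η d (τ : 𝔸 →ₗ[ℂ] ℂ) (curL (flat115 Y)))
    (h79 : ∀ Y : Space115 L η lev₀ lev₁ Dc, P Y → pair27 τ (Δ₁ Y) (flat115 Y)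
      = pair27 τ (Δπ Y) (flat115 Y) - 2 * pair27 τ (Jcur (L := L) (η := η) (lev₀ := lev₀) U₀) (flat115 (H (quadPart C Y))))
    (hPT : ∀ Y : Space115 L η lev₀ lev₁ Dc, ‖Y‖ < aC → P Y → P (T47 H C εC Y))
    (hPadd : ∀ Y Z : Space115 L η lev₀ lev₁ Dc, P Y → P Z → P (Y + Z)) (hPsmul : ∀ (c : ℂ) (Y : Space115 L η lev₀ lev₁ Dc), P Y → P (c • Y))
    {A' : Space115 L η lev₀ lev₁ Dc} (hA' : ‖A'‖ < aC) (hPA : P A') {δ' : Space115 L η lev₀ lev₁ Dc} (hPδ : P δ') :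
    HasDerivAt (fun t : ℂ => actionZ Tsh η d (τ : 𝔸 →ₗ[ℂ] ℂ) (prodCfg (Ucur U₀) η (curL (flat115 (T47 H C εC (A' + t • δ'))))))
      (pair27 τ (Jcur (L := L) (η := η) (lev₀ := lev₀) U₀) (flat115 δ') + pair27 τ (Δ₁ A') (flat115 δ')
        + pair27 τ (W80 ρ τ U₀ H C εC (Jcur (L := L) (η := η) (lev₀ := lev₀) U₀) Δπ A') (flat115 δ')) 0 := by
  refine (hasDerivAt_rhs81_line hρ hτ U₀ RC hC hΔ hΔ₁ hA' δ').congr_of_eventuallyEq ?_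
  -- near `t = 0` the ray stays in the ball, and it stays in `P` for every `t`
  have hcont : ContinuousAt (fun t : ℂ => A' + t • δ') 0 := by fun_prop
  have hball : ball (0 : Space115 L η lev₀ lev₁ Dc) aC ∈ 𝓝 ((fun t : ℂ => A' + t • δ') 0) := by
    simpa only [zero_smul, add_zero] using isOpen_ball.mem_nhds (mem_ball_zero_iff.2 hA')
  filter_upwards [hcont.eventually_mem hball] with t ht
  have hPt := hPadd _ _ hPA (hPsmul t δ' hPδ)
  exact actionZ_chart_eq81_of_mem hτ U₀ εC hΔ P h74 h79 hPt (hPT _ (mem_ball_zero_iff.1 ht) hPt)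

/-- ★★★ **(84) ON THE LATTICE, REAL RAY, EVERY `d`** — the variational problem's form ((82)–(83): real `δA′`): the chart ray
`t : ℝ ↦ A(U₁((A′ + tδ) − HD(A′ + tδ))·U₀)` HAS DERIVATIVE `⟨J, δ⟩ + ⟨Δ₁A′, δ⟩ + ⟨W(A′), δ⟩` at `0`, for `A′`, `δ` in `P` (`P` closed under
`+` and REAL scalars only, and under `T47` on the ball). [cite: Balaban1985Variational, (84) p.290, (82)–(83) p.290] -/
theorem hasDerivAt_actionZ_chartRay_real (hρ : ∀ (ℓ : 𝔸 →L[ℂ] ℂ) (X : 𝔸), τ (ρ ℓ * X) = ℓ X)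
    (hτ : ∀ a b : 𝔸, τ (a * b) = τ (b * a))
    (U₀ : Bond d Pd → 𝔸ˣ) (RC : Regime H 0 C b 0 C₂ c₄ 0 aC εC) (hC : Prop4Hyp C C₂ c₄) [CompleteSpace 𝒳]
    {Δπ Δ₁ : Space115 L η lev₀ lev₁ Dc →L[ℂ] NegSize L η lev₀ 3 𝔸}
    (hΔ : ∀ Y Z : Space115 L η lev₀ lev₁ Dc, pair27 τ (Δπ Y) (flat115 Z) = pair27 τ (Δπ Z) (flat115 Y))
    (hΔ₁ : ∀ Y Z : Space115 L η lev₀ lev₁ Dc, pair27 τ (Δ₁ Y) (flat115 Z) = pair27 τ (Δ₁ Z) (flat115 Y))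
    (P : Space115 L η lev₀ lev₁ Dc → Prop)
    (h74 : ∀ Y : Space115 L η lev₀ lev₁ Dc, P Y →
      pair27 τ (Δπ Y) (flat115 Y) = hessPair Tsh (Ucur U₀) η d (τ : 𝔸 →ₗ[ℂ] ℂ) (curL (flat115 Y)))
    (h79 : ∀ Y : Space115 L η lev₀ lev₁ Dc, P Y → pair27 τ (Δ₁ Y) (flat115 Y)
      = pair27 τ (Δπ Y) (flat115 Y) - 2 * pair27 τ (Jcur (L := L) (η := η) (lev₀ := lev₀) U₀) (flat115 (H (quadPart C Y))))
    (hPT : ∀ Y : Space115 L η lev₀ lev₁ Dc, ‖Y‖ < aC → P Y → P (T47 H C εC Y))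
    (hPadd : ∀ Y Z : Space115 L η lev₀ lev₁ Dc, P Y → P Z → P (Y + Z)) (hPsmul : ∀ (r : ℝ) (Y : Space115 L η lev₀ lev₁ Dc), P Y → P ((r : ℂ) • Y))
    {A' : Space115 L η lev₀ lev₁ Dc} (hA' : ‖A'‖ < aC) (hPA : P A') {δ' : Space115 L η lev₀ lev₁ Dc} (hPδ : P δ') :
    HasDerivAt (fun t : ℝ => actionZ Tsh η d (τ : 𝔸 →ₗ[ℂ] ℂ) (prodCfg (Ucur U₀) η (curL (flat115 (T47 H C εC (A' + (t : ℂ) • δ'))))))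
      (pair27 τ (Jcur (L := L) (η := η) (lev₀ := lev₀) U₀) (flat115 δ') + pair27 τ (Δ₁ A') (flat115 δ')
        + pair27 τ (W80 ρ τ U₀ H C εC (Jcur (L := L) (η := η) (lev₀ := lev₀) U₀) Δπ A') (flat115 δ')) 0 := by
  have h := hasDerivAt_rhs81_line hρ hτ U₀ RC hC hΔ hΔ₁ hA' δ'
  rw [← Complex.ofReal_zero] at h
  refine h.comp_ofReal.congr_of_eventuallyEq ?_
  have hcont : ContinuousAt (fun t : ℝ => A' + (t : ℂ) • δ') 0 := by fun_prop
  have hball : ball (0 : Space115 L η lev₀ lev₁ Dc) aC ∈ 𝓝 ((fun t : ℝ => A' + (t : ℂ) • δ') 0) := by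
    simpa only [Complex.ofReal_zero, zero_smul, add_zero] using isOpen_ball.mem_nhds (mem_ball_zero_iff.2 hA')
  filter_upwards [hcont.eventually_mem hball] with t ht
  have hPt := hPadd _ _ hPA (hPsmul t δ' hPδ)
  exact actionZ_chart_eq81_of_mem hτ U₀ εC hΔ P h74 h79 hPt (hPT _ (mem_ball_zero_iff.1 ht) hPt)

end Literature.MathematicalPhysics.QuantumFieldTheory.Balaban1983to89.B11Eq81ExpansionZpow

end
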